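/-
Copyright (c) 2026. All rights reserved.
Released under Apache 2.0 license as described in the file LICENSE.
-/
import Summits.HodgeConjecture.HodgeConjecture.Theorems.K2LiuLocalSWCoordinateLattices   -- ★ F3e `blkB_matA_mul_of_mem`, `blkB_matA_inv_of_mem` (+ ★ `K2LiuUnipDeltaLocalCoordinates`)
import HarnessLib

/-!
# Crux `HLiu418`, #42S organ S1, ROAD W, file F3f: THE PROFILE SUM RE-INDEXED OVER SKEW MATRICES `mod Λ₀` (the `hsum` binder of ★ `spanning_criterion`)

Cell `hodgecm-mathlib`, crux item hLiu418 = `stmt-HodgeConjecture-24832`; squad K2 ∕ K2Liu; prover K2Liu-p06 (g4), the dedicated S1 hand.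
THEOREMS ONLY (no `def`, no instance, no notation, no named-fact hypothesis, no `sorry`); lane `--supports stmt-HodgeConjecture-24832 --as helper`.

The last witness binder of ★ F3d-CM `localDegPS_le_of_witness` is the PROFILE SUM `∑_{q ∈ N₁ ⧸ N₀} f₀(w_Δ q̃) ≠ 0` over the finite group quotient `N₁ ⧸ (N₀ ∩ N₁)` of the
coordinate subgroups `N_Λ = {u ∈ N_Δ : B(u) ∈ Λ}` (★ F3e).  The witness hands compute `f₀(w_Δ n(t))` as a function of the SKEW MATRIX `t mod Λ₀` (★ F4a big-cell formula) and
count over matrices; this file moves the sum to that side once and for all: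
* §1 `exists_skewAddSubgroup`: `𝔰_Λ = {t skew : t ∈ Λ}` is an additive subgroup of `M_n(E ⊗ F_v)` for every additive subgroup `Λ`.
* §2 **`exists_equiv_quotient`**: the coordinate `B` induces a bijection `N_Λ ⧸ (N_{Λ₀} ∩ N_Λ) ≃ 𝔰_Λ ⧸ (𝔰_{Λ₀} ∩ 𝔰_Λ)` carrying the class of `u` to the class of `B(u)`
  (so the two `Fintype`∕`Finite` structures have the same cardinality, `card_quotient_eq`);
* §3 **`sum_quotient_eq_sum_skewQuotient`**: for every `g : H_v → ℂ` right-`N_{Λ₀}`-invariant on `N_Λ`,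
  `∑_{q ∈ N_Λ ⧸ N_{Λ₀}} g(q̃) = ∑_{r ∈ 𝔰_Λ ⧸ 𝔰_{Λ₀}} g(n(r̃))` — with ANY `Fintype` instances on the two sides (the organ applies it to `g = f₀(w_Δ ·)`).
References: [BernsteinZelevinsky1976] §1.5; [Kudla1994] §3; [HarrisKudlaSweet1996] §1 (1.11)–(1.12).
HONEST LABEL.  Count-neutral helper: `HC_CM` is proved only modulo the 7 printed citations (2 remaining named inputs: hLiu418 = `stmt-HodgeConjecture-24832`,
h413 = `stmt-HodgeConjecture-24833`) until rung 0 closes.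
-/

set_option autoImplicit false
set_option linter.dupNamespace false -- the mandated namespace repeats `HodgeConjecture.HodgeConjecture`

noncomputable section

open NumberField IsDedekindDomain Matrix
open Literature.NumberTheory.Automorphic Literature.NumberTheory.Automorphic.UnitaryGroup
open Literature.NumberTheory.GelbartRogawski1991.AdaptedBlocks
open Literature.NumberTheory.GelbartRogawski1991.UnitaryDualPair.LocalSplitting
open Literature.NumberTheory.K2Lit.LocalSiegelDoubled
open Summit.HodgeConjecture.HodgeConjecture.Cruxes.HLiu418.K2LiuUnipDeltaLocalCoordinates
open Summit.HodgeConjecture.HodgeConjecture.Cruxes.HLiu418.K2LiuLocalSWCoordinateLattices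

namespace Summit.HodgeConjecture.HodgeConjecture.Cruxes.HLiu418.K2LiuLocalSWCoordinateQuotient

variable (F : Type) [Field F] [NumberField F] (E : Type) [Field E] [NumberField E] [Algebra F E]
  (c : E ≃ₐ[F] E) (v : HeightOneSpectrum (𝓞 F)) (n : ℕ) {T₀ : Matrix (Fin n) (Fin n) F}
  {JD : Matrix (Fin (n + n)) (Fin (n + n)) E} (hJD : JD = (gramD F n T₀).map (algebraMap F E))

/-! ## §1 The skew part of an additive subgroup -/

/-- **`𝔰_Λ = {t : σ(t)ᵀ T₀ + T₀ t = 0, t ∈ Λ}` is an additive subgroup** of `M_n(E ⊗ F_v)` (★ `skew_add`, `skew_zero`, `skew_neg`). [cite: HarrisKudlaSweet1996, §1 (1.12)] -/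
theorem exists_skewAddSubgroup (Λ : AddSubgroup (Matrix (Fin n) (Fin n) (LocalRing E v))) :
    ∃ S : AddSubgroup (Matrix (Fin n) (Fin n) (LocalRing E v)),
      ∀ t, t ∈ S ↔ (t.map (conjLocal E c v))ᵀ * gramS F E v n T₀ + gramS F E v n T₀ * t = 0 ∧ t ∈ Λ :=
  ⟨{ carrier := {t | (t.map (conjLocal E c v))ᵀ * gramS F E v n T₀ + gramS F E v n T₀ * t = 0 ∧ t ∈ Λ}
     add_mem' := fun ht ht' => ⟨skew_add F E c v n ht.1 ht'.1, Λ.add_mem ht.2 ht'.2⟩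
     zero_mem' := ⟨skew_zero F E c v n, Λ.zero_mem⟩
     neg_mem' := fun ht => ⟨skew_neg F E c v n ht.1, Λ.neg_mem ht.2⟩ }, fun _ => Iff.rfl⟩

/-! ## §2 The bijection `N_Λ ⧸ N_{Λ₀} ≃ 𝔰_Λ ⧸ 𝔰_{Λ₀}` -/

include hJD in
/-- **THE COORDINATE BIJECTION ON COSETS.**  For coordinate subgroups `N₀ = N_{Λ₀}`, `N₁ = N_Λ` (★ F3e) and the skew parts `S₀ = 𝔰_{Λ₀}`, `S₁ = 𝔰_Λ` there is a bijection
`e : N₁ ⧸ (N₀ ∩ N₁) ≃ S₁ ⧸ (S₀ ∩ S₁)` with `e [u] = [B(u)]`, i.e. `[n(r̃)] = e⁻¹ r`: precisely, for every class `q`, `n((e q)̃) = q̃ · u₀` with `u₀ ∈ N₀`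
(`B` is an isomorphism `N_Δ ≅ (𝔰, +)`, ★ `eq_nElem_of_mem_unipDeltaLocal`, ★ `blkB_matA_nElem`, ★ F3e). [cite: HarrisKudlaSweet1996, §1 (1.12)] [cite: BernsteinZelevinsky1976, §1.5] -/
theorem exists_equiv_quotient {Λ₀ Λ : Set (Matrix (Fin n) (Fin n) (LocalRing E v))}
    {N₀ N₁ : Subgroup (UnitaryGroup.localPi E c (n + n) JD v)}
    (hN₀ : ∀ u, u ∈ N₀ ↔ u ∈ unipDeltaLocal F E c v n (JD := JD) ∧ blkB (matA F E c v n u) ∈ Λ₀)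
    (hN₁ : ∀ u, u ∈ N₁ ↔ u ∈ unipDeltaLocal F E c v n (JD := JD) ∧ blkB (matA F E c v n u) ∈ Λ)
    {S₀ S₁ : AddSubgroup (Matrix (Fin n) (Fin n) (LocalRing E v))}
    (hS₀ : ∀ t, t ∈ S₀ ↔ (t.map (conjLocal E c v))ᵀ * gramS F E v n T₀ + gramS F E v n T₀ * t = 0 ∧ t ∈ Λ₀)
    (hS₁ : ∀ t, t ∈ S₁ ↔ (t.map (conjLocal E c v))ᵀ * gramS F E v n T₀ + gramS F E v n T₀ * t = 0 ∧ t ∈ Λ) :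
    ∃ e : N₁ ⧸ N₀.subgroupOf N₁ ≃ S₁ ⧸ S₀.addSubgroupOf S₁,
      ∀ q : N₁ ⧸ N₀.subgroupOf N₁, ∃ u₀ ∈ N₀,
        nElem F E c v n hJD (e q).out.1 ((hS₁ _).1 (e q).out.2).1 =
          ((q.out : N₁) : UnitaryGroup.localPi E c (n + n) JD v) * u₀ := by
  classical
  -- `B : N₁ ≃ S₁`
  have hB : ∀ u : N₁, (blkB (matA F E c v n (u : UnitaryGroup.localPi E c (n + n) JD v))) ∈ S₁ := fun u =>
    (hS₁ _).2 ⟨skew_blkB_of_mem_unipDeltaLocal F E c v n hJD ((hN₁ _).1 u.2).1, ((hN₁ _).1 u.2).2⟩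
  have hn : ∀ t : S₁, nElem F E c v n hJD t.1 ((hS₁ _).1 t.2).1 ∈ N₁ := fun t =>
    (hN₁ _).2 ⟨nElem_mem_unipDeltaLocal F E c v n hJD _ _, by rw [blkB_matA_nElem]; exact ((hS₁ _).1 t.2).2⟩
  let φ : N₁ ≃ S₁ :=
    { toFun := fun u => ⟨_, hB u⟩
      invFun := fun t => ⟨_, hn t⟩
      left_inv := fun u => Subtype.ext (eq_nElem_of_mem_unipDeltaLocal F E c v n hJD ((hN₁ _).1 u.2).1).symm
      right_inv := fun t => Subtype.ext (blkB_matA_nElem F E c v n hJD ((hS₁ _).1 t.2).1) }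
  have hφ : ∀ u : N₁, (φ u).1 = blkB (matA F E c v n (u : UnitaryGroup.localPi E c (n + n) JD v)) :=
    fun _ => rfl
  -- compatible with the coset relations
  have hrel : ∀ u u' : N₁, (QuotientGroup.leftRel (N₀.subgroupOf N₁)) u u' ↔ (QuotientAddGroup.leftRel (S₀.addSubgroupOf S₁)) (φ u) (φ u') := by
    intro u u'
    rw [QuotientGroup.leftRel_apply, QuotientAddGroup.leftRel_apply, Subgroup.mem_subgroupOf, AddSubgroup.mem_addSubgroupOf, hN₀, hS₀,
      Subgroup.coe_mul, Subgroup.coe_inv, AddSubgroup.coe_add, AddSubgroup.coe_neg, hφ, hφ,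
      blkB_matA_mul_of_mem F E c v n hJD (Subgroup.inv_mem _ ((hN₁ _).1 u.2).1) ((hN₁ _).1 u'.2).1,
      blkB_matA_inv_of_mem F E c v n hJD ((hN₁ _).1 u.2).1]
    constructor
    · rintro ⟨-, h⟩
      exact ⟨skew_add F E c v n (skew_neg F E c v n (skew_blkB_of_mem_unipDeltaLocal F E c v n hJD ((hN₁ _).1 u.2).1))
        (skew_blkB_of_mem_unipDeltaLocal F E c v n hJD ((hN₁ _).1 u'.2).1), h⟩
    · rintro ⟨-, h⟩
      exact ⟨Subgroup.mul_mem _ (Subgroup.inv_mem _ ((hN₁ _).1 u.2).1) ((hN₁ _).1 u'.2).1, h⟩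
  refine ⟨Quotient.congr φ hrel, fun q => ?_⟩
  -- `(e q).out = B(q.out) + t₀` with `t₀ ∈ S₀ ∩ S₁`
  have hq : Quotient.congr φ hrel q = (QuotientAddGroup.mk (φ q.out) : S₁ ⧸ S₀.addSubgroupOf S₁) := by
    conv_lhs => rw [← QuotientGroup.out_eq' q]
    rfl
  obtain ⟨t₀, ht₀⟩ := QuotientAddGroup.mk_out_eq_mul (S₀.addSubgroupOf S₁) (φ q.out)
  have hval : (Quotient.congr φ hrel q).out.1 =
      blkB (matA F E c v n ((q.out : N₁) : UnitaryGroup.localPi E c (n + n) JD v)) + (t₀ : S₁).1 := by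
    rw [hq, ht₀, AddSubgroup.coe_add, hφ]
  have ht₀S : (t₀ : S₁).1 ∈ S₀ := AddSubgroup.mem_addSubgroupOf.1 t₀.2
  refine ⟨nElem F E c v n hJD _ ((hS₀ _).1 ht₀S).1, (hN₀ _).2 ⟨nElem_mem_unipDeltaLocal F E c v n hJD _ _, by
    rw [blkB_matA_nElem]; exact ((hS₀ _).1 ht₀S).2⟩, ?_⟩
  have hu : ((q.out : N₁) : UnitaryGroup.localPi E c (n + n) JD v) ∈ unipDeltaLocal F E c v n (JD := JD) := ((hN₁ _).1 q.out.2).1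
  conv_rhs => rw [eq_nElem_of_mem_unipDeltaLocal F E c v n hJD hu]
  rw [← nElem_add]
  exact matA_injective F E c v n (eq_of_adapt_eq (by rw [adapt_matA_nElem, adapt_matA_nElem, hval]))

include hJD in
/-- the two coset spaces have the same cardinality. [cite: BernsteinZelevinsky1976, §1.5] -/
theorem card_quotient_eq {Λ₀ Λ : Set (Matrix (Fin n) (Fin n) (LocalRing E v))}
    {N₀ N₁ : Subgroup (UnitaryGroup.localPi E c (n + n) JD v)}
    (hN₀ : ∀ u, u ∈ N₀ ↔ u ∈ unipDeltaLocal F E c v n (JD := JD) ∧ blkB (matA F E c v n u) ∈ Λ₀)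
    (hN₁ : ∀ u, u ∈ N₁ ↔ u ∈ unipDeltaLocal F E c v n (JD := JD) ∧ blkB (matA F E c v n u) ∈ Λ)
    {S₀ S₁ : AddSubgroup (Matrix (Fin n) (Fin n) (LocalRing E v))}
    (hS₀ : ∀ t, t ∈ S₀ ↔ (t.map (conjLocal E c v))ᵀ * gramS F E v n T₀ + gramS F E v n T₀ * t = 0 ∧ t ∈ Λ₀)
    (hS₁ : ∀ t, t ∈ S₁ ↔ (t.map (conjLocal E c v))ᵀ * gramS F E v n T₀ + gramS F E v n T₀ * t = 0 ∧ t ∈ Λ) :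
    Nat.card (N₁ ⧸ N₀.subgroupOf N₁) = Nat.card (S₁ ⧸ S₀.addSubgroupOf S₁) := by
  obtain ⟨e, -⟩ := exists_equiv_quotient F E c v n hJD hN₀ hN₁ hS₀ hS₁
  exact Nat.card_congr e

/-! ## §3 The profile sum -/

include hJD in
/-- **THE PROFILE SUM OVER SKEW MATRICES `mod Λ₀`.**  For every `g : H_v → ℂ` which is right-`N₀`-invariant on `N₁` (the organ's `g = f₀(w_Δ ·)`, ★ `spanning_criterion`'s
`hf₀inv`), `∑_{q ∈ N₁ ⧸ N₀} g(q̃) = ∑_{r ∈ 𝔰_Λ ⧸ 𝔰_{Λ₀}} g(n(r̃))`, for ANY `Fintype` structures on the two finite coset spaces and any choice of representatives.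
[cite: BernsteinZelevinsky1976, §1.5] [cite: Kudla1994, §3] [cite: HarrisKudlaSweet1996, §1 (1.11)–(1.12)] -/
theorem sum_quotient_eq_sum_skewQuotient {Λ₀ Λ : Set (Matrix (Fin n) (Fin n) (LocalRing E v))}
    {N₀ N₁ : Subgroup (UnitaryGroup.localPi E c (n + n) JD v)}
    (hN₀ : ∀ u, u ∈ N₀ ↔ u ∈ unipDeltaLocal F E c v n (JD := JD) ∧ blkB (matA F E c v n u) ∈ Λ₀)
    (hN₁ : ∀ u, u ∈ N₁ ↔ u ∈ unipDeltaLocal F E c v n (JD := JD) ∧ blkB (matA F E c v n u) ∈ Λ)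
    {S₀ S₁ : AddSubgroup (Matrix (Fin n) (Fin n) (LocalRing E v))}
    (hS₀ : ∀ t, t ∈ S₀ ↔ (t.map (conjLocal E c v))ᵀ * gramS F E v n T₀ + gramS F E v n T₀ * t = 0 ∧ t ∈ Λ₀)
    (hS₁ : ∀ t, t ∈ S₁ ↔ (t.map (conjLocal E c v))ᵀ * gramS F E v n T₀ + gramS F E v n T₀ * t = 0 ∧ t ∈ Λ)
    [Fintype (N₁ ⧸ N₀.subgroupOf N₁)] [Fintype (S₁ ⧸ S₀.addSubgroupOf S₁)]
    (g : UnitaryGroup.localPi E c (n + n) JD v → ℂ)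
    (hg : ∀ u ∈ N₁, ∀ u₀ ∈ N₀, g (u * u₀) = g u) :
    ∑ q : N₁ ⧸ N₀.subgroupOf N₁, g ((q.out : N₁) : UnitaryGroup.localPi E c (n + n) JD v) =
      ∑ r : S₁ ⧸ S₀.addSubgroupOf S₁, g (nElem F E c v n hJD r.out.1 ((hS₁ _).1 r.out.2).1) := by
  obtain ⟨e, he⟩ := exists_equiv_quotient F E c v n hJD hN₀ hN₁ hS₀ hS₁
  refine Fintype.sum_equiv e _ _ fun q => ?_
  obtain ⟨u₀, hu₀, hq⟩ := he q
  rw [hq, hg _ q.out.2 u₀ hu₀]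

end Summit.HodgeConjecture.HodgeConjecture.Cruxes.HLiu418.K2LiuLocalSWCoordinateQuotient

end
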